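import Literature.MathematicalPhysics.QuantumFieldTheory.Balaban1983to89.B9Eq3119DeltaPiTower
import Literature.MathematicalPhysics.QuantumFieldTheory.Balaban1983to89.B5Eq172HodgePositivity

/-!
# `Balaban1983to89.B9Eq3119DeltaPiTowerFlat` — T. Bałaban, *Propagators for lattice gauge theories in a background field*, Commun. Math. Phys. **99**
# (1985) 389–434 [Balaban1985BackgroundPropagators] (3.117)–(3.119) p. 419, (3.122) p. 420, (3.130) p. 421 with (3.3)–(3.4) p. 391 and (3.10) p. 392:
# **AT THE FLAT BACKGROUND `U ≡ 1` PRINT's OPERATOR (3.122) IS THE CHAIN's (3.26): `Δ̃_{a,k}(1) = Δ_{a,k}(1)`** — the Hessian `Δ^η(1) = ∂*∂` kills every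
# pure gauge mode on both sides (curl of a gradient vanishes, `Δ′(1) = 0`), so the gauge-invariant extension `π†Δ^η(1)π` of (3.119) coincides with `Δ^η(1)`
# for EVERY `π = 1 − D∘P`, and `B9Eq3119DeltaPiTower.laplaceAkPi` at `U ≡ 1` equals `B9Eq326OperatorTower.laplaceAk` at `U ≡ 1` as linear maps

statement-level skeleton of published theorems with citation tags; proofs where landed; nothing here is a claim about the Yang–Mills mass gap

CITATION HEADER (lean-in-tree rule).  Audit cell `pub-balaban`, sub-cell `t4`, BINDER row NE9; filed by NE9 crux-team (2) leaf prover 03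
(`b2b-balaban-t4-ne9-formalise-leaf-03`, gen 67), INTENT I-ne9leaf03-g67-E, for the row OWNER t4-ne9-p1's plan v7 «the Δ_π port» (DIAGNOSIS D-ne9p1-g87-1:
«the two families coincide iff (g1) — i.e. only at `U ≡ 1`»; this file types the `U ≡ 1` half as an equality of operators).  Sources READ in the held text
`paper:balaban1985-cmp99-background-propagators` (journal page = PDF page + 388) pp. 391–392, 419–421.  Objects BY NAME: `hessOp`, `principalOpK`, `curvOp`,
`covCurlL2K`, `covDerivL2K`, `piOfUk`, `laplaceAkPi`, `laplaceAk`, `G1LatticeK`, `KinvLatticeK`, `H1LatticeK`, `frakGLatticeK`; nothing re-declared, 0 `def`.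

THE PRINT (verbatim).  p. 419: *«⟨Dλ, J⟩ = 0, or D*J = 0, ⟨A − Dλ, Δ(A − Dλ)⟩ = ⟨A, ΔA⟩ − ⟨…, J⟩. (3.117) The last equality can be interpreted as almost invariance
of the quadratic form, the error terms are small because the function J = D*η⁻²Im ∂U is small»* — at `U ≡ 1` the current `J` VANISHES and (3.117) is EXACT invariance;
p. 392: *«the basic operator generalizing the operator ∂*∂ in the Abelian case»*; p. 421: *«G₀ = (Δ + DRD* + Q*aQ)⁻¹ … G = G₀(I − Δ′_πG₀)⁻¹ (3.130)»* — at `U ≡ 1`,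
`Δ′_π = 0` and `G = G₀`.

WHY THIS FILE (cell context).  The port (ii)–(iv-G) (`B9Eq34CurlGaugeModeWindow`, `B9Eq3120DeltaPiPrimeFormDiagonal(Closed)`, `B9Eq3130HessianSlotPerturbation*`,
`B9Eq3120DeltaPiPrimeFormTwoWindows`, `B9Eq3153FrakGkBoundSlotDiagonal`) controls print's letters at `U` against the chain's letters AT THE SAME `U` (`O(θα)`).  The
chain's two-background Lipschitz rows and every FLAT letter (`laplaceAk_one_pos`, the flat Hodge coercivity, `B9Eq3126KFloorTowerDiagonal`, `H_k(1)`, `𝔊_k(1)`) are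
stated at `laplaceAk … 1 …`.  This file identifies the two operators AT THE FLAT POINT exactly, so that (a) every flat letter of the chain IS a letter of print's
operator at `U ≡ 1` by rewriting, and (b) the two-background rows for print's letters, `X̃_k(U) − X̃_k(1)`, are `(X̃_k(U) − X_k(U)) + (X_k(U) − X_k(1))` with NO
third term.

WHAT IS PROVED (sorry-free; proof lane — 0 `def`; [folklore] lattice calculus at the identity transporter).
* §1 (any torus `TSite d Pd`) **`covCurlL2K_covDerivL2K_one`**: `curl₁(D₁λ) = 0` on the `L²` spaces (`B9Eq34CovCurlVector.covCurl_covDeriv_flat` read through the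
  identifications); **`hessOp_one_covDerivL2K`**: `Δ^η(1)(D₁λ) = 0` (`D*D = D†D`, `Δ′(1) = 0`); **`inner_covDerivL2K_hessOp_one`**: `⟨D₁λ, Δ^η(1)w⟩ = 0`
  (adjointness at the flat transporters — no symmetry used).
* §2 **`adjoint_pi_hessOp_one_pi`**: for EVERY linear `P : bonds → sites`, with `π := 1 − D₁ ∘ P`: `π† ∘ Δ^η(1) ∘ π = Δ^η(1)` — the three terms of
  `⟨πu, Δπv⟩ − ⟨u, Δv⟩` each pair `Δ^η(1)` with a pure gauge mode.
* §3 (the tower `towerP L m (n+1)`) **`laplaceAkPi_one_eq_laplaceAk_one`**: `laplaceAkPi L m n φ τ η 1 a′ hpos′ hL αU hα1 hU1 hreg a = laplaceAk L m n φ η 1 hL αU hα1 hU1 hreg τ a`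
  for ANY `a′`, `hpos′` and ANY E162 data at the flat background — PRINT's `Δ̃_{a,k}(1)` IS THE CHAIN's `Δ_{a,k}(1)`; corollaries **`laplaceAkPi_one_pos_iff`**
  (the positivity witnesses correspond) and **`greenK_laplaceAkPi_one`** (`G̃_k(1) = G_k(1)` for corresponding witnesses).
* Interlude (any torus; private `letters_congr_slot`): the lattice letters `G1LatticeK`, `KinvLatticeK`, `H1LatticeK`, `frakGLatticeK` of `Δ_{1,a} = Δ₁ + DRD* + Q*aQ`
  see the slot `Δ₁` only through its value (equal slots, any two witnesses ⇒ equal letters; `subst` + `rfl`).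
* §4 **`letters_laplaceAkPi_one`**: for ANY witnesses `hpos₁` (print's operator at `1`), `hpos1` (the chain's at `1`) and ANY `hQ`: `G1LatticeK hpos₁ = G1LatticeK hpos1`,
  `KinvLatticeK hpos₁ hQ = KinvLatticeK hpos1 hQ`, `H1LatticeK hpos₁ hQ = H1LatticeK hpos1 hQ` ((3.126): `H̃_{1,k}(1) = H_{1,k}(1)`), `frakGLatticeK hpos₁ hQ =
  frakGLatticeK hpos1 hQ` ((3.153): `𝔊̃_k(1) = 𝔊_k(1)`) — §2's slot identity through the interlude; pointwise forms **`H1LatticeK_laplaceAkPi_one`**,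
  **`frakGLatticeK_laplaceAkPi_one`**.
HONEST SCOPE.  [folklore]; exact algebra at `U ≡ 1`, no estimate, no window; nothing of [B9] asserted beyond the quoted sentences; «NE9 ⇐ the named binders»; NE9 NOT
PRINTED ∕ NOT PROVED; NOT summit progress (cell pub-balaban: row NE9 WALLED ON A MODEL (O-NE9-1; #5 UNRULED); spine PROVED 0/9; rung (B)+1 finite T⁴ — NOT infinite
volume, NOT mass gap, NOT BetaPertH, NOT Clay; HONEST DEPENDENCY: continuum YM on T⁴ ⇐ BetaPertH ∧ nine spine estimates (0/9 proved); BetaPertH ⇐ (D1) ∧ (D4) ∧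
CAP+tail; G-an2-4 gates asym, D1 and NE2/3/4).  NEW file; nothing modified.  Net new unproved facts: 0.
-/

noncomputable section

open scoped InnerProductSpace ComplexConjugate BigOperators

namespace Literature.MathematicalPhysics.QuantumFieldTheory.Balaban1983to89.B9Eq3119DeltaPiTowerFlat

open B4Sect5Torus (TSite)
open B9SectCLatticeCarrier (Bond)
open B9Eq311L2Pairing (WL2)
open B9Eq34CovCurlVector (covCurl_covDeriv_flat)
open B11Eq103H1Complex (SiteL2K BondL2K covDerivL2K covDivL2K laplaceALatticeK greenK equiv_covDerivL2K
  G1LatticeK KinvLatticeK H1LatticeK frakGLatticeK)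
open B9Eq310HessianOperator (adTransportW hessOp hessOp_one principalOpK principalOpK_eq_comp covCurlL2K covCoCurlL2K equiv_covCurlL2K
  covCoCurlL2K_comp_eq_adjoint_comp)
open B5Eq172HodgePositivity (adTransportW_one adTransportW_inv_one hRS_one conj_inv_ofReal)
open B9Eq315QTorus (perCfg cornerSite)
open B9Eq315QTower (towerP UlevOf)
open B9Eq326OperatorTower (laplaceAk QkW RofUk)
open B9Eq324DeltaPrimeATower (laplacePrimeAk GpOfUk)
open B9Eq3119DeltaPiTower (piOfUk laplaceAkPi)
open B7Prop1Explicit (U1 Wcx boxVec)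

/-! ## §1 `Δ^η(1)` kills every pure gauge mode, on both sides -/

section Flat

variable {d : ℕ} {Pd : Fin d → ℕ} {𝔸 : Type*} [NormedRing 𝔸] [NormedAlgebra ℂ 𝔸] [StarRing 𝔸] [StarModule ℂ 𝔸]
  {W : Type*} [NormedAddCommGroup W] [InnerProductSpace ℂ W] [FiniteDimensional ℂ W] (φ : W ≃ₗ[ℂ] 𝔸) {c₀ : ℝ} [Fact (0 < c₀)]
  (c : ℂ)

omit [StarRing 𝔸] [StarModule ℂ 𝔸] [FiniteDimensional ℂ W] in
/-- **`curl₁(D₁λ) = 0`**: at the flat background the lattice curl of the lattice gradient vanishes identically, on the `L²` spaces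
(`B9Eq34CovCurlVector.covCurl_covDeriv_flat` through the identifications, the flat transporter being the identity on the fibre).
[cite: Balaban1985BackgroundPropagators, (3.3)–(3.4) p.391] -/
theorem covCurlL2K_covDerivL2K_one (l : SiteL2K ℂ d Pd c₀ W) :
    covCurlL2K ℂ c₀ c (adTransportW φ (fun _ : Bond d Pd => (1 : 𝔸ˣ)))
      (covDerivL2K ℂ c₀ c (adTransportW φ (fun _ : Bond d Pd => (1 : 𝔸ˣ))) l) = 0 := by
  have h1 : (adTransportW φ (fun _ : Bond d Pd => (1 : 𝔸ˣ))) = fun _ => (LinearMap.id : W →ₗ[ℂ] W) := by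
    funext b; exact adTransportW_one φ b
  rw [h1]
  apply (WL2.equiv ℂ (fun _ : B9SectCLatticeCarrier.Plaq d Pd => c₀) W).injective
  funext p
  rw [equiv_covCurlL2K, equiv_covDerivL2K, WL2.equiv_zero]
  exact covCurl_covDeriv_flat c _ p

variable (η : ℝ) (τ : 𝔸 →ₗ[ℂ] ℂ)

/-- **`Δ^η(1)(D₁λ) = 0`** — the flat Hessian `∂*∂` kills the pure gauge modes: `D*D(D₁λ) = D†(curl₁ D₁λ) = 0` and `Δ′(1) = 0`
(print's (3.117) at `J = 0`: EXACT invariance). [cite: Balaban1985BackgroundPropagators, (3.117) p.419, (3.10) p.392] -/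
theorem hessOp_one_covDerivL2K (l : SiteL2K ℂ d Pd c₀ W) :
    hessOp φ η (fun _ : Bond d Pd => (1 : 𝔸ˣ)) τ
      (covDerivL2K ℂ c₀ ((η : ℂ))⁻¹ (adTransportW φ (fun _ : Bond d Pd => (1 : 𝔸ˣ))) l) = 0 := by
  rw [hessOp_one, principalOpK_eq_comp, LinearMap.comp_apply]
  have h : covCurlL2K ℂ c₀ ((η : ℂ))⁻¹ (adTransportW φ (fun _ : Bond d Pd => (1 : 𝔸ˣ)))
      (covDerivL2K ℂ c₀ ((η : ℂ))⁻¹ (adTransportW φ (fun _ : Bond d Pd => (1 : 𝔸ˣ))) l) = 0 := covCurlL2K_covDerivL2K_one φ _ l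
  rw [h, map_zero]

/-- **`⟨D₁λ, Δ^η(1)w⟩ = 0`** — the pure gauge mode in the LEFT slot: `⟨D₁λ, D†D w⟩ = ⟨curl₁D₁λ, curl₁w⟩ = 0`, by the adjointness of the flat curl
(no symmetry of `Δ^η` used). [cite: Balaban1985BackgroundPropagators, (3.117) p.419, (3.9)–(3.10) p.392] -/
theorem inner_covDerivL2K_hessOp_one (l : SiteL2K ℂ d Pd c₀ W) (w : BondL2K ℂ d Pd c₀ W) :
    ⟪covDerivL2K ℂ c₀ ((η : ℂ))⁻¹ (adTransportW φ (fun _ : Bond d Pd => (1 : 𝔸ˣ))) l,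
      hessOp φ η (fun _ : Bond d Pd => (1 : 𝔸ˣ)) τ w⟫_ℂ = 0 := by
  rw [hessOp_one, principalOpK_eq_comp,
    covCoCurlL2K_comp_eq_adjoint_comp ((η : ℂ))⁻¹ (conj_inv_ofReal η) _ _ (by
      intro b v u
      have h := hRS_one (d := d) (Pd := Pd) φ b v u
      rw [inv_one]
      rw [adTransportW_inv_one] at h
      rw [adTransportW_one] at h ⊢
      exact h),
    LinearMap.comp_apply, LinearMap.adjoint_inner_right, covCurlL2K_covDerivL2K_one, inner_zero_left]

/-! ## §2 At `U ≡ 1` the gauge-invariant extension is the Hessian itself -/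

/-- **`π† ∘ Δ^η(1) ∘ π = Δ^η(1)` FOR EVERY `π = 1 − D₁ ∘ P`** (`P` any linear map from bond to site fields): expanding
`⟨πu, Δπv⟩ − ⟨u, Δv⟩ = −⟨u, Δ(D₁Pv)⟩ − ⟨D₁Pu, Δv⟩ + ⟨D₁Pu, Δ(D₁Pv)⟩`, every term pairs `Δ^η(1)` with a pure gauge mode (§1).  Print's (3.119) at
the flat point: `Δ_π = Δ`. [cite: Balaban1985BackgroundPropagators, (3.119) p.419, (3.117) p.419] -/
theorem adjoint_pi_hessOp_one_pi (P : BondL2K ℂ d Pd c₀ W →ₗ[ℂ] SiteL2K ℂ d Pd c₀ W) :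
    LinearMap.adjoint ((LinearMap.id : BondL2K ℂ d Pd c₀ W →ₗ[ℂ] BondL2K ℂ d Pd c₀ W) -
          covDerivL2K ℂ c₀ ((η : ℂ))⁻¹ (adTransportW φ (fun _ : Bond d Pd => (1 : 𝔸ˣ))) ∘ₗ P) ∘ₗ
        hessOp φ η (fun _ : Bond d Pd => (1 : 𝔸ˣ)) τ ∘ₗ
        ((LinearMap.id : BondL2K ℂ d Pd c₀ W →ₗ[ℂ] BondL2K ℂ d Pd c₀ W) -
          covDerivL2K ℂ c₀ ((η : ℂ))⁻¹ (adTransportW φ (fun _ : Bond d Pd => (1 : 𝔸ˣ))) ∘ₗ P) =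
      hessOp φ η (fun _ : Bond d Pd => (1 : 𝔸ˣ)) τ := by
  apply LinearMap.ext
  intro v
  apply ext_inner_left ℂ
  intro u
  rw [LinearMap.comp_apply, LinearMap.comp_apply, LinearMap.adjoint_inner_right]
  simp only [LinearMap.sub_apply, LinearMap.id_apply, LinearMap.comp_apply, map_sub, hessOp_one_covDerivL2K, sub_zero,
    inner_sub_left, inner_covDerivL2K_hessOp_one]

end Flat

/-! ## Interlude: the lattice letters of `Δ_{1,a}` depend on the slot `Δ₁` only through its value -/

section Congr

variable {d : ℕ} {Pd : Fin d → ℕ} {W : Type*} [NormedAddCommGroup W] [InnerProductSpace ℂ W] [FiniteDimensional ℂ W] {c₀ : ℝ} [Fact (0 < c₀)]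
  {F : Type*} [NormedAddCommGroup F] [InnerProductSpace ℂ F] [FiniteDimensional ℂ F]
  {c : ℂ} {R S : Bond d Pd → W →ₗ[ℂ] W} {Δ₁ Δ₁' : BondL2K ℂ d Pd c₀ W →ₗ[ℂ] BondL2K ℂ d Pd c₀ W}
  {Rr : SiteL2K ℂ d Pd c₀ W →ₗ[ℂ] SiteL2K ℂ d Pd c₀ W} {Q : BondL2K ℂ d Pd c₀ W →ₗ[ℂ] F} {a : ℝ}

/-- Equal slots give equal letters `G₁`, `(QG₁Q*)⁻¹`, `H₁`, `𝔊` of `Δ_{1,a} = Δ₁ + DRD* + Q*aQ`, whatever the two positivity witnesses. [folklore] -/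
private theorem letters_congr_slot (e : Δ₁ = Δ₁')
    (h : ∀ x : BondL2K ℂ d Pd c₀ W, x ≠ 0 → 0 < RCLike.re ⟪x, laplaceALatticeK c R S Δ₁ Rr Q a x⟫_ℂ)
    (h' : ∀ x : BondL2K ℂ d Pd c₀ W, x ≠ 0 → 0 < RCLike.re ⟪x, laplaceALatticeK c R S Δ₁' Rr Q a x⟫_ℂ) (hQ : Function.Surjective Q) :
    G1LatticeK h = G1LatticeK h' ∧ KinvLatticeK h hQ = KinvLatticeK h' hQ ∧ H1LatticeK h hQ = H1LatticeK h' hQ ∧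
      frakGLatticeK h hQ = frakGLatticeK h' hQ := by
  subst e
  exact ⟨rfl, rfl, rfl, rfl⟩

end Congr

/-! ## §3 Print's `Δ̃_{a,k}(1)` is the chain's `Δ_{a,k}(1)` -/

section Tower

variable {d : ℕ} (L : ℕ) [NeZero L] (m : Fin d → ℕ) [∀ i, NeZero (m i)] (n : ℕ)
  {𝔸 : Type*} [NormedRing 𝔸] [NormedAlgebra ℂ 𝔸] [CompleteSpace 𝔸] [NormOneClass 𝔸] [StarRing 𝔸] [StarModule ℂ 𝔸]
  {W : Type*} [NormedAddCommGroup W] [InnerProductSpace ℂ W] [FiniteDimensional ℂ W] (φ : W ≃ₗ[ℂ] 𝔸) {c₀ : ℝ} [Fact (0 < c₀)]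
  (τ : 𝔸 →ₗ[ℂ] ℂ) (η : ℝ) {c₁ : ℝ} [Fact (0 < c₁)] (a' : ℝ)
  (hpos' : ∀ x : SiteL2K ℂ d (towerP L m (n + 1)) c₀ W, x ≠ 0 →
    0 < RCLike.re ⟪x, laplacePrimeAk L m n φ η (fun _ : Bond d (towerP L m (n + 1)) => (1 : 𝔸ˣ)) a' (c₁ := c₁) x⟫_ℂ)
  (hL : 1 ≤ L) (αU : ℕ → ℝ) (hα1 : ∀ j, αU j ≤ 1 / 64)
  (hU1 : ∀ (j : ℕ) (x : B7Prop1Explicit.Site d) (κ : Fin d),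
    perCfg (towerP L m (j + 1)) (UlevOf L m (n + 1) (fun _ : Bond d (towerP L m (n + 1)) => (1 : 𝔸ˣ)) j) x κ ∈ U1 𝔸)
  (hreg : ∀ (j : ℕ) (y : TSite d (towerP L m j)) (κ : Fin d) (r : Fin d → Fin L),
    ‖((Wcx L (perCfg (towerP L m (j + 1)) (UlevOf L m (n + 1) (fun _ : Bond d (towerP L m (n + 1)) => (1 : 𝔸ˣ)) j))
      (cornerSite L y) κ (boxVec L r) : 𝔸ˣ) : 𝔸) - 1‖ ≤ αU j)
  (a : ℝ)

/-- **PRINT's OPERATOR (3.122) AT THE FLAT BACKGROUND IS THE CHAIN's (3.26)**: `Δ̃_{a,k}(1) = Δ_{a,k}(1)` as linear maps — for ANY `a′`, ANY positivity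
witness `hpos′` of `Δ′_{a′,k}(1)` (so for the actual `G′_k(1)`) and ANY E162 data; `π_k(1) = 1 − D₁G′_k(1)R_k(1)D₁*` is one of §2's `π`s
(`B9Eq3119DeltaPiTower.piOfUk` unfolds to `1 − D₁ ∘ (G′ ∘ R_k ∘ D₁*)`). [cite: Balaban1985BackgroundPropagators, (3.122) p.420, (3.26) p.395, (3.119) p.419, (3.130) p.421] -/
theorem laplaceAkPi_one_eq_laplaceAk_one :
    laplaceAkPi L m n φ τ η (fun _ : Bond d (towerP L m (n + 1)) => (1 : 𝔸ˣ)) a' hpos' hL αU hα1 hU1 hreg (c₁ := c₁) a =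
      laplaceAk L m n φ η (fun _ : Bond d (towerP L m (n + 1)) => (1 : 𝔸ˣ)) hL αU hα1 hU1 hreg τ (c₀ := c₀) (c₁ := c₁) a := by
  have h := adjoint_pi_hessOp_one_pi (d := d) (Pd := towerP L m (n + 1)) φ (c₀ := c₀) η τ
    (GpOfUk L m n φ η (fun _ : Bond d (towerP L m (n + 1)) => (1 : 𝔸ˣ)) a' hpos' ∘ₗ
      RofUk L m n φ η (fun _ : Bond d (towerP L m (n + 1)) => (1 : 𝔸ˣ)) ∘ₗ
      covDivL2K ℂ c₀ ((η : ℂ))⁻¹ (adTransportW φ fun b => ((fun _ : Bond d (towerP L m (n + 1)) => (1 : 𝔸ˣ)) b)⁻¹))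
  simp only [laplaceAkPi, laplaceAk, piOfUk] at h ⊢
  rw [h]

/-- **THE POSITIVITY WITNESSES CORRESPOND**: `Δ̃_{a,k}(1)` is positive definite iff `Δ_{a,k}(1)` is — so the chain's `laplaceAk_one_pos`
(`B9Eq326OperatorTowerFlat`) inhabits the `hpos` of print's operator at the flat background. [cite: Balaban1985BackgroundPropagators, (3.122) p.420, Thm 3.11 p.416] -/
theorem laplaceAkPi_one_pos_iff :
    (∀ x : BondL2K ℂ d (towerP L m (n + 1)) c₀ W, x ≠ 0 →
        0 < RCLike.re ⟪x, laplaceAkPi L m n φ τ η (fun _ : Bond d (towerP L m (n + 1)) => (1 : 𝔸ˣ)) a' hpos' hL αU hα1 hU1 hreg (c₁ := c₁) a x⟫_ℂ) ↔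
      (∀ x : BondL2K ℂ d (towerP L m (n + 1)) c₀ W, x ≠ 0 →
        0 < RCLike.re ⟪x, laplaceAk L m n φ η (fun _ : Bond d (towerP L m (n + 1)) => (1 : 𝔸ˣ)) hL αU hα1 hU1 hreg τ (c₀ := c₀) (c₁ := c₁) a x⟫_ℂ) := by
  rw [laplaceAkPi_one_eq_laplaceAk_one]

/-- **`G̃_k(1) = G_k(1)`**: the Green's functions of the two operators at the flat background agree, for any pair of positivity witnesses
(the inverse of the same operator; `greenK` does not depend on the witness). [cite: Balaban1985BackgroundPropagators, (3.130) p.421, (3.122) p.420] -/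
theorem greenK_laplaceAkPi_one
    (hpos₁ : ∀ x : BondL2K ℂ d (towerP L m (n + 1)) c₀ W, x ≠ 0 →
      0 < RCLike.re ⟪x, laplaceAkPi L m n φ τ η (fun _ : Bond d (towerP L m (n + 1)) => (1 : 𝔸ˣ)) a' hpos' hL αU hα1 hU1 hreg (c₁ := c₁) a x⟫_ℂ)
    (hpos1 : ∀ x : BondL2K ℂ d (towerP L m (n + 1)) c₀ W, x ≠ 0 →
      0 < RCLike.re ⟪x, laplaceAk L m n φ η (fun _ : Bond d (towerP L m (n + 1)) => (1 : 𝔸ˣ)) hL αU hα1 hU1 hreg τ (c₀ := c₀) (c₁ := c₁) a x⟫_ℂ)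
    (y : BondL2K ℂ d (towerP L m (n + 1)) c₀ W) :
    greenK (laplaceAkPi L m n φ τ η (fun _ : Bond d (towerP L m (n + 1)) => (1 : 𝔸ˣ)) a' hpos' hL αU hα1 hU1 hreg (c₁ := c₁) a) hpos₁ y =
      greenK (laplaceAk L m n φ η (fun _ : Bond d (towerP L m (n + 1)) => (1 : 𝔸ˣ)) hL αU hα1 hU1 hreg τ (c₀ := c₀) (c₁ := c₁) a) hpos1 y := by
  have hinj : Function.Injective
      (laplaceAk L m n φ η (fun _ : Bond d (towerP L m (n + 1)) => (1 : 𝔸ˣ)) hL αU hα1 hU1 hreg τ (c₀ := c₀) (c₁ := c₁) a) :=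
    B11Eq103H1Complex.injective_of_rePosDef hpos1
  apply hinj
  rw [B11Eq103H1Complex.apply_greenK hpos1 y, ← laplaceAkPi_one_eq_laplaceAk_one L m n φ τ η a' hpos' hL αU hα1 hU1 hreg a]
  exact B11Eq103H1Complex.apply_greenK hpos₁ y

/-! ## §4 Print's `G̃_{1}(1)`, `(Q_kG̃Q_k*)⁻¹(1)`, `H̃_{1,k}(1)`, `𝔊̃_k(1)` are the chain's -/

/-- **PRINT's LETTERS AT THE FLAT BACKGROUND ARE THE CHAIN's**: for ANY positivity witnesses `hpos₁` of `Δ̃_{a,k}(1)` and `hpos1` of `Δ_{a,k}(1)` and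
ANY `hQ`, the four lattice letters agree as linear maps — `G̃₁(1) = G₁(1)`, `(Q_kG̃₁Q_k*)⁻¹(1) = (Q_kG₁Q_k*)⁻¹(1)`, `H̃_{1,k}(1) = H_{1,k}(1)` ((3.126)),
`𝔊̃_k(1) = 𝔊_k(1)` ((3.153)): the slots `π_k(1)†Δ^η(1)π_k(1)` and `Δ^η(1)` are EQUAL (§2), and the letters see the slot only through its value.
So the two-background rows «`X̃_k(U) − X̃_k(1)`» for print's letters reduce to «`X̃_k(U) − X_k(U)`» plus the chain's «`X_k(U) − X_k(1)`».
[cite: Balaban1985BackgroundPropagators, (3.122) p.420, (3.126) p.420, (3.153) p.426, (3.119) p.419] -/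
theorem letters_laplaceAkPi_one
    (hpos₁ : ∀ x : BondL2K ℂ d (towerP L m (n + 1)) c₀ W, x ≠ 0 →
      0 < RCLike.re ⟪x, laplaceAkPi L m n φ τ η (fun _ : Bond d (towerP L m (n + 1)) => (1 : 𝔸ˣ)) a' hpos' hL αU hα1 hU1 hreg (c₁ := c₁) a x⟫_ℂ)
    (hpos1 : ∀ x : BondL2K ℂ d (towerP L m (n + 1)) c₀ W, x ≠ 0 →
      0 < RCLike.re ⟪x, laplaceAk L m n φ η (fun _ : Bond d (towerP L m (n + 1)) => (1 : 𝔸ˣ)) hL αU hα1 hU1 hreg τ (c₀ := c₀) (c₁ := c₁) a x⟫_ℂ)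
    (hQ : Function.Surjective
      (QkW L m n φ (fun _ : Bond d (towerP L m (n + 1)) => (1 : 𝔸ˣ)) hL αU hα1 hU1 hreg (c₀ := c₀) (c₁ := c₁))) :
    G1LatticeK hpos₁ = G1LatticeK hpos1 ∧ KinvLatticeK hpos₁ hQ = KinvLatticeK hpos1 hQ ∧ H1LatticeK hpos₁ hQ = H1LatticeK hpos1 hQ ∧
      frakGLatticeK hpos₁ hQ = frakGLatticeK hpos1 hQ :=
  letters_congr_slot
    (adjoint_pi_hessOp_one_pi (d := d) (Pd := towerP L m (n + 1)) φ (c₀ := c₀) η τ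
      (GpOfUk L m n φ η (fun _ : Bond d (towerP L m (n + 1)) => (1 : 𝔸ˣ)) a' hpos' ∘ₗ
        RofUk L m n φ η (fun _ : Bond d (towerP L m (n + 1)) => (1 : 𝔸ˣ)) ∘ₗ
        covDivL2K ℂ c₀ ((η : ℂ))⁻¹ (adTransportW φ fun b => ((fun _ : Bond d (towerP L m (n + 1)) => (1 : 𝔸ˣ)) b)⁻¹)))
    hpos₁ hpos1 hQ

/-- **`H̃_{1,k}(1)b = H_{1,k}(1)b`** ((3.126) at the flat background), pointwise form of §4. [cite: Balaban1985BackgroundPropagators, (3.126) p.420, (3.122) p.420] -/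
theorem H1LatticeK_laplaceAkPi_one
    (hpos₁ : ∀ x : BondL2K ℂ d (towerP L m (n + 1)) c₀ W, x ≠ 0 →
      0 < RCLike.re ⟪x, laplaceAkPi L m n φ τ η (fun _ : Bond d (towerP L m (n + 1)) => (1 : 𝔸ˣ)) a' hpos' hL αU hα1 hU1 hreg (c₁ := c₁) a x⟫_ℂ)
    (hpos1 : ∀ x : BondL2K ℂ d (towerP L m (n + 1)) c₀ W, x ≠ 0 →
      0 < RCLike.re ⟪x, laplaceAk L m n φ η (fun _ : Bond d (towerP L m (n + 1)) => (1 : 𝔸ˣ)) hL αU hα1 hU1 hreg τ (c₀ := c₀) (c₁ := c₁) a x⟫_ℂ)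
    (hQ : Function.Surjective
      (QkW L m n φ (fun _ : Bond d (towerP L m (n + 1)) => (1 : 𝔸ˣ)) hL αU hα1 hU1 hreg (c₀ := c₀) (c₁ := c₁)))
    (b : BondL2K ℂ d m c₁ W) : H1LatticeK hpos₁ hQ b = H1LatticeK hpos1 hQ b := by
  rw [(letters_laplaceAkPi_one L m n φ τ η a' hpos' hL αU hα1 hU1 hreg a hpos₁ hpos1 hQ).2.2.1]

/-- **`𝔊̃_k(1)x = 𝔊_k(1)x`** ((3.153) at the flat background), pointwise form of §4. [cite: Balaban1985BackgroundPropagators, (3.153) p.426, (3.122) p.420] -/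
theorem frakGLatticeK_laplaceAkPi_one
    (hpos₁ : ∀ x : BondL2K ℂ d (towerP L m (n + 1)) c₀ W, x ≠ 0 →
      0 < RCLike.re ⟪x, laplaceAkPi L m n φ τ η (fun _ : Bond d (towerP L m (n + 1)) => (1 : 𝔸ˣ)) a' hpos' hL αU hα1 hU1 hreg (c₁ := c₁) a x⟫_ℂ)
    (hpos1 : ∀ x : BondL2K ℂ d (towerP L m (n + 1)) c₀ W, x ≠ 0 →
      0 < RCLike.re ⟪x, laplaceAk L m n φ η (fun _ : Bond d (towerP L m (n + 1)) => (1 : 𝔸ˣ)) hL αU hα1 hU1 hreg τ (c₀ := c₀) (c₁ := c₁) a x⟫_ℂ)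
    (hQ : Function.Surjective
      (QkW L m n φ (fun _ : Bond d (towerP L m (n + 1)) => (1 : 𝔸ˣ)) hL αU hα1 hU1 hreg (c₀ := c₀) (c₁ := c₁)))
    (x : BondL2K ℂ d (towerP L m (n + 1)) c₀ W) : frakGLatticeK hpos₁ hQ x = frakGLatticeK hpos1 hQ x := by
  rw [(letters_laplaceAkPi_one L m n φ τ η a' hpos' hL αU hα1 hU1 hreg a hpos₁ hpos1 hQ).2.2.2]

end Tower

end Literature.MathematicalPhysics.QuantumFieldTheory.Balaban1983to89.B9Eq3119DeltaPiTowerFlat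

end
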